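import Literature.Probability.LatticeModels.SHolomorphicPrimitive
import HarnessLib

/-!
# Corner fluxes are blind to the branch cut of a spinor section

Topic `Literature/Probability/LatticeModels`; a complement to `SHolomorphicPrimitive.lean`
(Smirnov 2010, Lemma 3.6: the flux form `q ↦ |Proj[F ; ℓ(q)]|²` of an s-holomorphic bond
function is closed around every medial vertex, so `H = Im ∫ F²` exists on simply connected
domains). The spinor observables of Chelkak–Hongler–Izyurov 2015 (Prop. 2.4: s-holomorphic with
multiplicative monodromy `-1` around the source) are realised in the tree by SECTIONS of the double
cover (`kcObs` of `IsingDisorderObservable.lean`), which are s-holomorphic off a seam and have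
OPPOSITE projections across the corners of the seam (`IsingDisorderSeam.lean`). Since the fluxes are
squared lengths, they do not see the seam: this file records the corresponding versions of the
closedness statement, with the hypothesis "`IsSHolAt` or opposite projections" (`RelAt`) at the two
corners — which is ALWAYS one of the two for the spin fermion at a lower corner (its two sign
conventions are `±1`-valued) — so that CHI's primitive `H_{[Ω_δ,a]}` (Prop. 3.6) exists on hole-free
lattice domains exactly like the FK primitive (`FKPrimitive.lean`, `HoleFreePotential.lean`).

* `RelAt F q`: `Proj[F(cSrc q)] = ± Proj[F(cTgt q)]`;
* `RelAt.cornerFlux_eq`: the flux through `q` can be read on either bond;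
* **`cornerFlux_cycle_of_relAt`** (Lemma 3.6 for spinor sections): the four fluxes around a medial
  vertex balance, `Φ(u,k) + Φ(u+e_k, k+2) = Φ(u+e_k, k+1) + Φ(u, k+3)`.

Everything is proved; no named fact.

## References

* S. Smirnov, Ann. of Math. 172 (2010), Lemma 3.6 [Smirnov2010].
* D. Chelkak, C. Hongler, K. Izyurov, Ann. of Math. 181 (2015), Prop. 2.4 and Prop. 3.6
  [ChelkakHonglerIzyurovAnnals2015].
-/

noncomputable section

namespace Literature.Probability.LatticeModels

open Complex

/-- **The relation of a spinor section across a corner**: the projections of the two bond values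
onto the corner line agree up to sign (`+`: s-holomorphic there; `-`: the corner lies on the branch
cut of the section). [cite: ChelkakHonglerIzyurovAnnals2015, Prop. 2.4 (monodromy -1)] -/
def RelAt (F : MedialVertex → ℂ) (q : Site 2 × Fin 4) : Prop :=
  projLine (cornerLine q.1 (cFace q)) (F (cSrc q)) = projLine (cornerLine q.1 (cFace q)) (F (cTgt q)) ∨
    projLine (cornerLine q.1 (cFace q)) (F (cSrc q)) = -projLine (cornerLine q.1 (cFace q)) (F (cTgt q))

/-- An s-holomorphic corner is a related corner. [folklore] -/
theorem IsSHolAt.relAt {F : MedialVertex → ℂ} {q : Site 2 × Fin 4} (h : IsSHolAt F q) : RelAt F q := Or.inl h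

/-- Opposite projections give a related corner. [folklore] -/
theorem relAt_of_eq_neg {F : MedialVertex → ℂ} {q : Site 2 × Fin 4}
    (h : projLine (cornerLine q.1 (cFace q)) (F (cSrc q)) = -projLine (cornerLine q.1 (cFace q)) (F (cTgt q))) :
    RelAt F q := Or.inr h

/-- **Fluxes are sign-blind**: at a related corner the flux can be read on the target bond. [cite: Smirnov2010, Lemma 3.6] -/
theorem RelAt.cornerFlux_eq {F : MedialVertex → ℂ} {q : Site 2 × Fin 4} (h : RelAt F q) :
    cornerFlux F q = ‖projLine (cornerLine q.1 (cFace q)) (F (cTgt q))‖ ^ 2 := by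
  unfold cornerFlux
  rcases h with h | h
  · rw [h]
  · rw [h, norm_neg]

/-- **Lemma 3.6 for spinor sections**: around the medial vertex `e_k` at `u` the four fluxes
balance as soon as the two corners `(u, k+3)` and `(u + e_k, k+1)` are related (s-holomorphic or
on the cut). [cite: Smirnov2010, Lemma 3.6; ChelkakHonglerIzyurovAnnals2015, Prop. 3.6] -/
theorem cornerFlux_cycle_of_relAt (F : MedialVertex → ℂ) (u : Site 2) (k : Fin 4)
    (h₁ : RelAt F (u, k + 3)) (h₂ : RelAt F (u + cornerUnit k, k + 1)) :
    cornerFlux F (u, k) + cornerFlux F (u + cornerUnit k, k + 2) =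
      cornerFlux F (u + cornerUnit k, k + 1) + cornerFlux F (u, k + 3) := by
  rw [h₁.cornerFlux_eq, h₂.cornerFlux_eq]
  simp only [cornerFlux, cFace]
  rw [cTgt_add_three, cTgt_add_cornerUnit_succ, cSrc_add_cornerUnit_add_two,
    norm_projLine_sq_add_two, show k + 3 = k + 1 + 2 by fin_cases k <;> rfl, norm_projLine_sq_add_two]

/-- **Negating the function on one bond does not change any flux.** [cite: Smirnov2010, Lemma 3.6] -/
theorem cornerFlux_eq_of_eq_neg {F G : MedialVertex → ℂ} {q : Site 2 × Fin 4}
    (h : G (cSrc q) = F (cSrc q) ∨ G (cSrc q) = -F (cSrc q)) : cornerFlux G q = cornerFlux F q := by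
  unfold cornerFlux
  rcases h with h | h
  · rw [h]
  · rw [h]
    have : projLine (cornerLine q.1 (cFace q)) (-F (cSrc q)) = -projLine (cornerLine q.1 (cFace q)) (F (cSrc q)) := by
      rw [projLine_eq, projLine_eq, ← neg_smul]
      congr 1
      rw [neg_mul, Complex.neg_re, neg_div]
    rw [this, norm_neg]

end Literature.Probability.LatticeModels
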